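import Summits.AtomisticToContinuum.Crystallization.Theorems.ReggeStarCoercivityDefectFreeCrystallizesAeMeckePricing
import HarnessLib

/-!
# Mecke pricing of an almost-sure certificate with an integrable level function (stub
# `stub_levelPricing` of line `palm-good-law`, crux `ReggeStarCoercivity.DefectFreeCrystallizes`,
# stmt-AtomisticToContinuum-13603)

**Theorem** (`stub_levelPricing`).  Let `P` be a point-stationary (`IsPointStationaryLaw`, the
Mecke / mass-transport identity) probability law on configurations of `ℝ³`, almost surely a rooted
`δ`-hard-core counting measure, and let `t : (configuration, atom) → ℝ` be a jointly measurable,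
bounded (`|t| ≤ M`), finite-range (`t μ y = 0` for `‖y‖ > R`) bond transfer with divergence at the
root `div t (μ) = ∫ (t μ y − t (θ_y μ) (−y)) dμ(y)`, `θ_y μ = μ.map (· − y)`.  Let `ℓ` be a
`P`-integrable LEVEL FUNCTION.  If `P`-almost surely `ℓ(μ) ≤ h(μ) + div t(μ)`
(`h(μ) = ½ ∫ V_LJ(‖y‖) dμ(y)`, the root energy) and moreover `ℓ(μ) + c₀ ≤ h(μ) + div t(μ)`
whenever `¬ G μ` (`c₀ ≥ 0`, `G` an arbitrary predicate), then
`E_P[ℓ] + c₀ · P*(¬ G) ≤ E_P[h]` (`P*` = Mathlib's outer measure of the possibly non-measurable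
event).

This is the level-FUNCTION version of the LANDED constant-level
`PalmGoodLaw.AeMeckePricing.stub_aeMeckePricing`.

**Proof.**  The landed `MeckePricing.exists_measurable_version` provides a measurable,
`P`-integrable `F` with `E_P[F] = E_P[h]` and `F = h + div t` almost surely.  Replace `ℓ` by a
measurable modification `ℓ'` (`AEMeasurable.mk`; `ℓ = ℓ'` a.s., so integrals and almost-sure
statements transfer).  With the MEASURABLE event `B = {ℓ' + c₀ ≤ F}`: almost surely
`ℓ' + c₀ 1_B ≤ F` (certificate, first clause), whence `E_P[ℓ'] + c₀ P(B) ≤ E_P[F] = E_P[h]`; and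
`{¬ G} ⊆ B` up to a `P`-null set (certificate, second clause), whence `P*(¬ G) ≤ P(B)`
(`measure_mono_ae`).  All `[folklore]`.
-/

noncomputable section

open MeasureTheory
open scoped ENNReal

namespace Summit.AtomisticToContinuum.Crystallization.Theorems.PalmGoodLaw.LevelPricing

open Literature.Probability.Process (IsPointStationaryLaw IsRootedHardCore)
open Literature.MathematicalPhysics.StatisticalMechanics (lennardJones rootEnergy rootEnergy_def)
open Summit.AtomisticToContinuum.Crystallization.Theorems.MinimiserShells.Negative.LoadBearing (meanRootEnergy)
open Summit.AtomisticToContinuum.Crystallization.Theorems.MinimiserShells.Negative.Rootedness (E3)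
open Summit.AtomisticToContinuum.Crystallization.Theorems.PalmUnimodularRigidityMinimiserShells.MeckePricing
  (exists_measurable_version)

/-- **Pricing a measurable version against a measurable level function** (the integration step,
generalising `AeMeckePricing.level_add_price_measure_le` from a constant level to a level
function).  If `F` and `ℓ` are measurable and `P`-integrable and almost surely `ℓ ≤ F`, then for
the measurable event `B = {ℓ + c₀ ≤ F}` (any real `c₀`) one has `E_P[ℓ] + c₀ · P(B) ≤ E_P[F]`:
integrate the almost-sure inequality `ℓ + c₀ 1_B ≤ F`. [folklore] -/
theorem levelFun_add_price_measure_le {P : Measure (Measure E3)} [IsFiniteMeasure P]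
    {F ℓ : Measure E3 → ℝ} (hFm : Measurable F) (hFi : Integrable F P)
    (hℓm : Measurable ℓ) (hℓi : Integrable ℓ P) (c₀ : ℝ) (hae : ∀ᵐ μ ∂P, ℓ μ ≤ F μ) :
    (∫ μ, ℓ μ ∂P) + c₀ * (P {μ | ℓ μ + c₀ ≤ F μ}).toReal ≤ ∫ μ, F μ ∂P := by
  set B : Set (Measure E3) := {μ | ℓ μ + c₀ ≤ F μ} with hB
  have hBm : MeasurableSet B := measurableSet_le (hℓm.add_const c₀) hFm
  -- almost surely `ℓ + c₀ 1_B ≤ F`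
  have hpt : ∀ᵐ μ ∂P, ℓ μ + B.indicator (fun _ => c₀) μ ≤ F μ := by
    filter_upwards [hae] with μ hμ
    by_cases hb : μ ∈ B
    · rw [Set.indicator_of_mem hb]
      exact hb
    · rw [Set.indicator_of_notMem hb, add_zero]
      exact hμ
  -- integrate
  have hind : Integrable (B.indicator fun _ => c₀) P := (integrable_const c₀).indicator hBm
  have hle := integral_mono_ae (hℓi.fun_add hind) hFi hpt
  rw [integral_add hℓi hind, integral_indicator_const c₀ hBm, smul_eq_mul, measureReal_def] at hle
  calc (∫ μ, ℓ μ ∂P) + c₀ * (P B).toReal = (∫ μ, ℓ μ ∂P) + (P B).toReal * c₀ := by rw [mul_comm]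
    _ ≤ ∫ μ, F μ ∂P := hle

/-- **stub_levelPricing** (line `palm-good-law`): Mecke pricing of an ALMOST-SURE pointwise
certificate against a `P`-integrable LEVEL FUNCTION `ℓ`.  For a point-stationary probability law
`P` a.s. carried by rooted `δ`-hard-core configurations, a jointly measurable bounded finite-range
bond transfer `t`, an arbitrary predicate `G`, a `P`-integrable level function `ℓ` and a price
`c₀ ≥ 0`: if almost surely `ℓ(μ) ≤ h(μ) + div t(μ)`, and moreover `ℓ(μ) + c₀ ≤ h(μ) + div t(μ)`
when `¬ G μ`, then `E_P[ℓ] + c₀ · P*(¬ G) ≤ E_P[h]` (`P*` = outer measure; Mecke kills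
`E_P[div t]` through the landed measurable version `MeckePricing.exists_measurable_version` of
`h + div t`, and `ℓ` is replaced by a measurable modification `AEMeasurable.mk`). [folklore] -/
theorem stub_levelPricing :
    ∀ δ : ℝ, 0 < δ → ∀ P : Measure (Measure (EuclideanSpace ℝ (Fin 3))), IsProbabilityMeasure P →
      (∀ᵐ μ ∂P, IsRootedHardCore δ μ) → IsPointStationaryLaw P →
      ∀ R M : ℝ, ∀ t : Measure (EuclideanSpace ℝ (Fin 3)) → EuclideanSpace ℝ (Fin 3) → ℝ,
        (Measurable (Function.uncurry t) ∧ (∀ μ y, |t μ y| ≤ M) ∧ ∀ μ y, R < ‖y‖ → t μ y = 0) →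
      ∀ G : Measure (EuclideanSpace ℝ (Fin 3)) → Prop, ∀ ℓ : Measure (EuclideanSpace ℝ (Fin 3)) → ℝ, Integrable ℓ P →
      ∀ c₀ : ℝ, 0 ≤ c₀ →
        (∀ᵐ μ ∂P,
          (ℓ μ ≤ (∫ y, lennardJones ‖y‖ ∂μ) / 2 +
              ∫ y, (t μ y - t (Measure.map (fun z => z - y) μ) (-y)) ∂μ) ∧
          (¬ G μ → ℓ μ + c₀ ≤ (∫ y, lennardJones ‖y‖ ∂μ) / 2 +
              ∫ y, (t μ y - t (Measure.map (fun z => z - y) μ) (-y)) ∂μ)) →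
        (∫ μ, ℓ μ ∂P) + c₀ * (P {μ | ¬ G μ}).toReal ≤ ∫ μ, (∫ y, lennardJones ‖y‖ ∂μ) / 2 ∂P := by
  intro δ hδ P hP hcore hstat R M t htMR G ℓ hℓ c₀ hc₀ hcert
  obtain ⟨ht, hM, hR⟩ := htMR
  obtain ⟨F, hFm, hFi, hFint, hFae⟩ := exists_measurable_version hδ P hcore hstat ht hM hR
  -- a measurable modification `ℓ'` of the level function
  have hℓa : AEMeasurable ℓ P := hℓ.aestronglyMeasurable.aemeasurable
  set ℓ' : Measure E3 → ℝ := hℓa.mk ℓ with hℓ'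
  have hℓ'm : Measurable ℓ' := hℓa.measurable_mk
  have hℓℓ' : ℓ =ᵐ[P] ℓ' := hℓa.ae_eq_mk
  have hℓ'i : Integrable ℓ' P := hℓ.congr hℓℓ'
  -- almost surely `ℓ' ≤ F` (certificate, first clause, on the a.s. set where `F = h + div t`)
  have hae : ∀ᵐ μ ∂P, ℓ' μ ≤ F μ := by
    filter_upwards [hcert, hFae, hℓℓ'] with μ hμ hF hl
    rw [← hl, hF, rootEnergy_def]
    exact hμ.1
  -- the outer measure of `{¬ G}` is at most `P {ℓ' + c₀ ≤ F}` (certificate, second clause, a.s.)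
  have hGB : P {μ | ¬ G μ} ≤ P {μ | ℓ' μ + c₀ ≤ F μ} := by
    refine measure_mono_ae ?_
    filter_upwards [hcert, hFae, hℓℓ'] with μ hμ hF hl hG
    show ℓ' μ + c₀ ≤ F μ
    rw [← hl, hF, rootEnergy_def]
    exact hμ.2 hG
  -- price the measurable version and compare
  have hle := levelFun_add_price_measure_le hFm hFi hℓ'm hℓ'i c₀ hae
  have hint : ∫ μ, ℓ μ ∂P = ∫ μ, ℓ' μ ∂P := integral_congr_ae hℓℓ'
  calc (∫ μ, ℓ μ ∂P) + c₀ * (P {μ | ¬ G μ}).toReal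
      = (∫ μ, ℓ' μ ∂P) + c₀ * (P {μ | ¬ G μ}).toReal := by rw [hint]
    _ ≤ (∫ μ, ℓ' μ ∂P) + c₀ * (P {μ | ℓ' μ + c₀ ≤ F μ}).toReal :=
        add_le_add le_rfl
          (mul_le_mul_of_nonneg_left (ENNReal.toReal_mono (measure_ne_top P _) hGB) hc₀)
    _ ≤ ∫ μ, F μ ∂P := hle
    _ = meanRootEnergy P := hFint

end Summit.AtomisticToContinuum.Crystallization.Theorems.PalmGoodLaw.LevelPricing

end
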